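import Literature.Probability.LatticeModels.OnsagerToeplitzProofs
import Literature.Probability.LatticeModels.OnsagerToeplitzDecay
import HarnessLib

/-!
# Wu's decay of the periodic row two-point function above `T_c`: the named fact discharged

Topic `Probability/LatticeModels`, namespace `Literature.Probability.LatticeModels`. Sibling proof
file of `OnsagerYangProofs.lean`, which introduced the named fact
`Literature.Probability.LatticeModels.torusRowPairLimit_exp_decay_of_lt_criticalBetaTwo`
— for `0 < β < β_c(2)` the iterated periodic limit `(σ_{(0,0)}σ_{(k,0)})_p(β) = lim_N lim_M ⟨σ_{(0,0)}σ_{(k,0)}⟩_{p,NM}`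
(BGJS (3.3)) decays exponentially in `k` (T. T. Wu, *Theory of Toeplitz determinants and the spin
correlations of the two-dimensional Ising model. I*, Phys. Rev. **149** (1966) 380–401, the
`T > T_c` asymptotics of the in-row correlation `D_N(φ_Onsager)`; recorded in P. Deift, A. Its,
I. Krasovsky, Comm. Pure Appl. Math. **66** (2013) 1360–1438, §5, eq. (64), with §4, eq. (50);
the exact-solution input of J. L. Lebowitz, Comm. Math. Phys. **28** (1972) 313–321, §III,
eq. (3.3), `β_O = β_c`) — as the exact-solution input of Lebowitz's `β_O = β_c` in the
Benettin–Gallavotti–Jona-Lasinio–Stella route to `onsager_yang` (**crit-ising.S16**).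

`OnsagerYangProofs.lean` cannot host the discharge itself (the Toeplitz files import it), hence
this sibling. The proof is the landed chain

* `OnsagerToeplitz.torusRowPairLimit_exp_decay_of_toeplitz hT hWu` — the reduction to the
  Toeplitz form of the exact solution (`(σσ)_p(β)(k) = Re D_k(φ_β)`, `Re ≤ |·|`);
* `OnsagerToeplitzProofs.torusRowPair_tendsto_toeplitzDet_holds` — `hT`: Montroll–Potts–Ward /
  Schultz–Mattis–Lieb, the cylinder row correlations converge to `D_k(φ_β)` (transfer matrix,
  Kaufman's rotation, Perron–Fock vacuum, Wick, `N → ∞`), proved;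
* `OnsagerToeplitzDecay.toeplitzDet_onsagerSymbol_exp_decay_holds` — `hWu`: `|D_k(φ_β)| ≤ C e^{-ck}`
  for `0 < β < β_c(2)` (winding number `-1`, triangular Toeplitz multipliers, Hadamard column
  bound), proved.

With it, Lebowitz's subcritical half of BGJS c), `m*(β) = 0` for `0 ≤ β < β_c(2)`, holds
unconditionally (`spontaneousMagnetization_two_eq_zero_of_lt_criticalBetaTwo_holds`, from
`OnsagerToeplitz.spontaneousMagnetization_two_eq_zero_of_toeplitz`), and of the three exact inputs
of `OnsagerYangProofs.onsager_yang_of_exactSolution` only the Montroll–Potts–Ward long-range order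
(`torusRowPairLimit_tendsto_onsagerYang_sq`, i.e. the strong Szegő limit theorem
`Literature.Analysis.Toeplitz.strongSzego` via `OnsagerToeplitz.onsager_yang_of_toeplitz`) remains a
named fact. No definitions, no new named facts.
-/

noncomputable section

namespace Literature.Probability.LatticeModels

/-- **Wu 1966, `T > T_c` (the named fact `torusRowPairLimit_exp_decay_of_lt_criticalBetaTwo`,
proved)**: for the nearest-neighbour Ising model on `ℤ²` and `0 < β < β_c(2) = ½ log(1+√2)` there
are `C` and `c > 0` with `(σ_{(0,0)}σ_{(k,0)})_p(β) ≤ C e^{-ck}` for all `k`, where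
`(σσ)_p = torusRowPairLimit β k` is the iterated periodic limit of BGJS (3.3) (T. T. Wu, Phys. Rev.
149 (1966) 380, `T > T_c` asymptotics `⟨σ_{0,0}σ_{0,N}⟩ ≃ c(β) N^{-1/2} γ₂^{-N}` of the in-row
correlation `D_N(φ_Onsager)`; Deift–Its–Krasovsky 2013, §5 eq. (64) with §4 eq. (50); Lebowitz
1972, §III eq. (3.3)). Obtained from the Toeplitz form of the exact solution
(`torusRowPair_tendsto_toeplitzDet_holds`) and the decay of the Toeplitz determinants of Onsager's
symbol above `T_c` (`toeplitzDet_onsagerSymbol_exp_decay_holds`) through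
`torusRowPairLimit_exp_decay_of_toeplitz`; only the weak form "some `c > 0`" of Wu's rate is
asserted, as in the fact. [cite: Wu1966, T > T_c asymptotics of the in-row correlation D_N(φ_Onsager) (= DeiftItsKrasovsky2013, §5, eq. (64) with §4, eq. (50))] -/
theorem torusRowPairLimit_exp_decay_of_lt_criticalBetaTwo_holds :
    torusRowPairLimit_exp_decay_of_lt_criticalBetaTwo :=
  torusRowPairLimit_exp_decay_of_toeplitz torusRowPair_tendsto_toeplitzDet_holds
    toeplitzDet_onsagerSymbol_exp_decay_holds

/-- **The subcritical half of BGJS c), unconditionally** (J. L. Lebowitz, Comm. Math. Phys. 28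
(1972) 313, §III: `β_O = β_c` for the two-dimensional square lattice — here the half
"`m*(β) = 0` for `0 ≤ β < β_O = β_c(2)`"; Benettin–Gallavotti–Jona-Lasinio–Stella 1973, §3 c);
Deift–Its–Krasovsky 2013, Remark 6): for the nearest-neighbour Ising model on `ℤ²` and
`0 ≤ β < ½ log(1+√2)`, the spontaneous magnetisation vanishes. This is
`OnsagerToeplitz.spontaneousMagnetization_two_eq_zero_of_toeplitz` (free row function ≤ periodic
limit ≤ `|D_k| ≤ C e^{-ck}`, then Messager–Miracle-Solé and the GHS boundary-field bound) with both
exact-solution inputs now theorems. [cite: Lebowitz1972, §III, eq. (3.3) and pp. 319–320 (β₀ = β_c for the two-dimensional square lattice)] -/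
theorem spontaneousMagnetization_two_eq_zero_of_lt_criticalBetaTwo_holds ⦃β : ℝ⦄ (hβ0 : 0 ≤ β)
    (hβ : β < criticalBetaTwo) : spontaneousMagnetization 2 β = 0 :=
  spontaneousMagnetization_two_eq_zero_of_toeplitz torusRowPair_tendsto_toeplitzDet_holds
    toeplitzDet_onsagerSymbol_exp_decay_holds hβ0 hβ

/-- **`onsager_yang` and `criticalBeta_two` from the strong Szegő limit theorem alone**: after the
two exact-solution discharges, the Onsager–Yang formula (`onsager_yang`, crit-ising.S16) and the
value of the critical point (`criticalBeta_two`, crit-ising.S15) are reduced to the single named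
fact `Literature.Analysis.Toeplitz.strongSzego` (Deift–Its–Krasovsky 2013, Thm. 7; Johansson 1988)
by `OnsagerToeplitz.onsager_yang_of_toeplitz` / `criticalBeta_two_of_toeplitz`. [cite: BenettinGallavottiJonaLasinioStella1973, §3 (main result)] -/
theorem onsager_yang_of_strongSzego (hSz : Literature.Analysis.Toeplitz.strongSzego) : onsager_yang :=
  onsager_yang_of_toeplitz torusRowPair_tendsto_toeplitzDet_holds hSz
    toeplitzDet_onsagerSymbol_exp_decay_holds

/-- `criticalBeta 2 = ½ log(1+√2)` (crit-ising.S15) from the strong Szegő limit theorem alone. [cite: BenettinGallavottiJonaLasinioStella1973, §3 c)] -/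
theorem criticalBeta_two_of_strongSzego (hSz : Literature.Analysis.Toeplitz.strongSzego) : criticalBeta_two :=
  criticalBeta_two_of_toeplitz torusRowPair_tendsto_toeplitzDet_holds hSz
    toeplitzDet_onsagerSymbol_exp_decay_holds

end Literature.Probability.LatticeModels
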